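import Literature.MathematicalPhysics.QuantumLattice.BoundedWilsonFlowLift
import Summits.QuantumFields.YangMills.Theorems.ParabolicTrajectoryContinuumLimitOnTrajectoryDefsB

/-!
# Route `ParabolicTrajectory`, crux `ContinuumLimitOnTrajectory` (stmt-QuantumFields-10522): vocabulary of line `curtiss-flowed-free-energies` (skeleton v2)

Route-posited objects (D-0016 `<Route><Crux>…Defs` file) shared by the registered stubs of the skeleton
`Cruxes/ContinuumLimitOnTrajectory/Lines/curtiss_flowed_free_energies.lean` (lead `prover-line-stmt-QuantumFields-10522-1`,
second seating) and by the files proving them; VERBATIM the skeleton's declarations (same namespace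
`…Cruxes.ContinuumLimitOnTrajectory.CurtissFlowedFreeEnergies`, so the registered signatures `stub_flowedFreeEnergyLimit :
Statement.stub_flowedFreeEnergyLimit`, `stub_flowContinuity : Statement.stub_flowContinuity`, `stub_curtiss : Statement.stub_curtiss`,
`stub_momentsOfFreeEnergies : Statement.stub_momentsOfFreeEnergies`, `stub_smallFlowTimeTransfer : Statement.stub_smallFlowTimeTransfer`,
`stub_uvRegularity : Statement.stub_uvRegularity`, `stub_clustering : Statement.stub_clustering` are unchanged).
NOTHING here is asserted: every `def … : Prop` is a line statement some registered stub proves or consumes (none is a literature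
fact, none restates the crux). The line is the planner's `curtiss-flowed-free-energies` RESHAPED onto the landed two-orbit vocabulary
(`…ContinuumLimitOnTrajectoryDefs{,B}`: `canon`, `curvNPoint`, `ConvProducts`, `UVB`, `AsympEuclid`, `ARP`, `UCL`, `ND2`, `ND3`,
`UVRegularity`, `ClusteringLeg`; packaging = the landed theorem `oneFieldOSLegs'`).
§1 flowed observables (`flowX`, `flowF`, `flowCMoment`), the hypothesis block `CruxHyp`, the stations `FFEConv`, `FlowMomentsConv`,
`FlowXContinuous`, `SFTApprox`, `CruxConcl`; §2 the two gauge-free statements `BoundedFlowedEnergyContinuous` (torus Wilson-flow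
continuity for every unitary `r.ρ` — tree debt recorded in `BoundedWilsonFlowLift`) and `CurtissTheorem` (Curtiss 1942 Thm 3,
multivariate); §3 the seven stub statements `Statement.stub_*`; §4 registered glue, proved (`tendsto_of_eventually_approx`,
`flowXContinuous_of`, `convProducts_of_sft`); §5 (appended after wave 1) the reshaped, `k`-matched small-flow-time stub
`SFTApproxK` / `Statement.stub_smallFlowTimeTransferK` with its glue `sftApproxK_of_sftApprox`, `convProducts_of_sftK`.
Refs: line card `Lines/curtiss-flowed-free-energies.md`; Luscher2010 eqs. (1.4), (3.1); Curtiss, Ann. Math. Statist. 13 (1942)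
430–433, Thm 3 (doi:10.1214/aoms/1177731541); LuscherWeisz2011 (arXiv:1101.0963); arXiv:1306.1173.
-/

set_option autoImplicit false

open scoped SchwartzMap
open MeasureTheory Filter Topology
open Literature.MathematicalPhysics.AQFT Literature.MathematicalPhysics.QuantumLattice
open Literature.Probability.LatticeModels
open Literature.MathematicalPhysics.QuantumFieldTheory
open Summit.QuantumFields.YangMills.Cruxes.ContinuumLimitOnTrajectory.TwoOrbitSynchronisation

noncomputable section

namespace Summit.QuantumFields.YangMills.Cruxes.ContinuumLimitOnTrajectory.CurtissFlowedFreeEnergies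

local notation "𝔼" => EuclideanSpace ℝ (Fin 4)

/-! ## §1 Objects of the line (flowed observables) and the stations -/

section Objects

variable {G : Type} [Group G] [TopologicalSpace G] [IsTopologicalGroup G] [CompactSpace G]
  [MeasurableSpace G] [BorelSpace G]

/-- The torus Wilson measure of the scheme at step `k` (side `2 L_k + 1`, coupling `β_k`). [folklore] -/
abbrev μW (r : LatticeRep G) (sch : SpeciesScheme (YMSpecies G)) (k : ℕ) :
    Measure (GaugeConfig 4 (sch.side k) G) :=
  wilsonMeasure (d := 4) (L := sch.side k) r.ρ (sch.β k)

/-- **The smeared flowed action density at physical flow time `τ`**: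
`X_k(τ, f)(U) = ∑_{x ∈ box} f(a_k x) · E_{τ/a_k²}(x)(Ũ)` with `E_t(x)` Lüscher's flowed plaquette density (3.1) along the
(bounded = torus) Wilson flow through `r.ρ` (tree `boundedFlowedEnergy`, lift lemma `boundedFlowedEnergy_torusLift`).
No explicit `a⁴`: the Riemann weight `a⁴` cancels the canonical weight `a⁻⁴` of the dimension-4 density. [cite: Luscher2010, eqs. (1.4), (3.1)] -/
def flowX (r : LatticeRep G) (sch : SpeciesScheme (YMSpecies G)) (τ : ℝ) (f : 𝓢(𝔼, ℝ)) (k : ℕ)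
    (U : GaugeConfig 4 (sch.side k) G) : ℝ :=
  ∑ x ∈ box 4 (sch.L k), f (sch.a k • siteToE x) *
    boundedFlowedEnergy r.ρ (τ / sch.a k ^ 2) x (torusLift (sch.side k) U)

/-- **The flowed free energy with real sources** `F_k(s⃗) = log ∫ exp(∑ᵢ sᵢ X_k(τ, fᵢ)) dμ_k`. [folklore] -/
def flowF (r : LatticeRep G) (sch : SpeciesScheme (YMSpecies G)) (τ : ℝ) (m : ℕ)
    (f : Fin m → 𝓢(𝔼, ℝ)) (s : Fin m → ℝ) (k : ℕ) : ℝ :=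
  Real.log (∫ U, Real.exp (∑ i, s i * flowX r sch τ (f i) k U) ∂(μW r sch k))

/-- **The centred mixed flowed moment** `∫ ∏ᵢ (X_k(τ,fᵢ) − ⟨X_k(τ,fᵢ)⟩_k) dμ_k`. [folklore] -/
def flowCMoment (r : LatticeRep G) (sch : SpeciesScheme (YMSpecies G)) (τ : ℝ) (m : ℕ)
    (f : Fin m → 𝓢(𝔼, ℝ)) (k : ℕ) : ℝ :=
  ∫ U, ∏ i, (flowX r sch τ (f i) k U - ∫ V, flowX r sch τ (f i) k V ∂(μW r sch k)) ∂(μW r sch k)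

/-- **Hypothesis block of the crux** for `(r, M, θ, Δ, sch, n)` (= `Disproof.Hyp`). [folklore] -/
def CruxHyp (r : LatticeRep G) (M : ℕ) (θ Δ : ℝ) (sch : SpeciesScheme (YMSpecies G)) (n : ℕ → ℕ) :
    Prop :=
  (∀ k, sch.a k = ((M : ℝ) ^ n k)⁻¹) ∧ Tendsto sch.β atTop atTop ∧
    (∀ t : ℕ, 0 < t → ∃ c : ℝ, Tendsto (fun k => ((M : ℝ) ^ n k) ^ 8 *
      latticeConnectedCorr r.ρ (sch.β k) (sch.side k) r.curvature.F r.curvature.F (t * M ^ n k))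
        atTop (𝓝 c)) ∧
    Tendsto (fun k => ((M : ℝ) ^ n k) ^ 8 *
      latticeConnectedCorr r.ρ (sch.β k) (sch.side k) r.curvature.F r.curvature.F (M ^ n k))
        atTop (𝓝 θ) ∧
    HasLatticeMassGap r sch Δ

/-- (ENGINE output) **flowed free energies converge** with small real sources, along the FULL sequence. [folklore] -/
def FFEConv (r : LatticeRep G) (sch : SpeciesScheme (YMSpecies G)) : Prop :=
  ∀ (m : ℕ) (f : Fin m → 𝓢(𝔼, ℝ)) (τ : ℝ), 0 < τ → ∃ δ : ℝ, 0 < δ ∧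
    ∀ s : Fin m → ℝ, (∀ i, |s i| < δ) → ∃ c : ℝ, Tendsto (fun k => flowF r sch τ m f s k) atTop (𝓝 c)

/-- (CURTISS output) **all centred mixed flowed moments converge**, every family, every `τ > 0`. [folklore] -/
def FlowMomentsConv (r : LatticeRep G) (sch : SpeciesScheme (YMSpecies G)) : Prop :=
  ∀ (m : ℕ) (f : Fin m → 𝓢(𝔼, ℝ)) (τ : ℝ), 0 < τ →
    ∃ c : ℝ, Tendsto (fun k => flowCMoment r sch τ m f k) atTop (𝓝 c)

/-- **The flowed observables are continuous** in the torus configuration (consequence of the flow-continuity stub). [folklore] -/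
def FlowXContinuous (r : LatticeRep G) (sch : SpeciesScheme (YMSpecies G)) : Prop :=
  ∀ τ : ℝ, 0 < τ → ∀ (f : 𝓢(𝔼, ℝ)) (k : ℕ), Continuous (flowX r sch τ f k)

/-- (SMALL FLOW TIME) **uniform small-flow-time approximation at separated points**, on the two-orbit vocabulary:
one matching function `c_E(τ)` such that for every off-diagonal real product tensor the CANONICAL unflowed `p`-point
function `curvNPoint` (`c = a⁻⁴`, exact centring) is within `ε` of `c_E(τ)ᵖ ×` the centred flowed moment, for `τ`
small and all large `k` (uniformity in `k` is the content). Source of the expansion: Lüscher–Weisz 2011 §2 (renormalisation-free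
flowed composites, small-flow-time expansion — NOT the `k`-uniformity); a LINE STATEMENT proved by the registered stub
`stub_smallFlowTimeTransfer` under `CruxHyp`, not a named fact. -/
def SFTApprox (r : LatticeRep G) (sch : SpeciesScheme (YMSpecies G)) : Prop :=
  ∃ cE : ℝ → ℝ, ∀ (p : ℕ), p ≠ 0 → ∀ (f : Fin p → 𝓢(𝔼, ℝ)),
    IsOffDiagonal (SchwartzMap.tensorFin p fun i => ofRealTest (f i)) →
      ∀ ε : ℝ, 0 < ε → ∃ τ : ℝ, 0 < τ ∧ ∀ᶠ k in atTop,
        |curvNPoint r sch k p f - cE τ ^ p * flowCMoment r sch τ p f k| ≤ ε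

/-- **Conclusion of the crux** for `(r, sch)` (= `Disproof.Concl`). [folklore] -/
def CruxConcl (r : LatticeRep G) (sch : SpeciesScheme (YMSpecies G)) : Prop :=
  ∃ sch' : SpeciesScheme (YMSpecies G), sch'.a = sch.a ∧ sch'.β = sch.β ∧ sch'.L = sch.L ∧
    ∃ T : OSData (YMSpecies G) 4,
      IsYangMillsFor r sch' T ∧ T.IsNontrivial r.curvature ∧ T.IsNonGaussian r.curvature

end Objects

/-! ## §2 Two gauge-free statements (tree debt / probability): continuity of the torus Wilson flow, Curtiss -/

/-- **Continuity of the torus Wilson-flowed action density in the configuration**, for EVERY compact `G` and every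
faithful unitary lattice representation `r` (global existence of Lüscher's flow line on the finite torus for unitary data —
Picard–Lindelöf for the cut-off field + invariance of the unitary sphere since `π_𝔤` of `range ρ ⊆ U(N)` is anti-Hermitian —
uniqueness `IsWilsonFlowLine.unique_of_finite`, Gronwall continuity in the data; then `boundedFlowedEnergy_torusLift`).
The tree has this for `SU(n)` only (`QuantumFieldTheory/WilsonFlow.lean`); source: Lüscher 2010, §1 p. 2 and App. C. A LINE STATEMENT here
(proved by the registered stub `stub_flowContinuity`), not a named fact. -/
def BoundedFlowedEnergyContinuous : Prop :=
  ∀ (G : Type) [Group G] [TopologicalSpace G] [IsTopologicalGroup G] [CompactSpace G]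
    (r : LatticeRep G) (S : ℕ) [NeZero S] (t : ℝ), 0 ≤ t → ∀ x : Fin 4 → ℤ,
      Continuous fun U : GaugeConfig 4 S G => boundedFlowedEnergy r.ρ t x (torusLift S U)

/-- **Curtiss' theorem, multivariate** (Curtiss 1942, Thm 3): probability laws `ν_k` on `ℝᵐ` whose moment generating
functions are finite and converge pointwise (to finite limits) on an open cube around `0` have convergent mixed moments
of every order. (Pointwise-convergent convex MGFs are bounded on the cube uniformly in `k`; exponential moment bounds give
`|m_α(k)| ≤ C α! δ^{-|α|}`; the MGFs are the multivariate power series of the moments on the cube; coefficientwise limits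
exist by compactness and are unique by the identity theorem.) Source: Curtiss, Ann. Math. Statist. 13 (1942), Thm 3. A LINE
STATEMENT here (proved by the registered stub `stub_curtiss`), not a named fact. -/
def CurtissTheorem : Prop :=
  ∀ (m : ℕ) (ν : ℕ → Measure (Fin m → ℝ)), (∀ k, IsProbabilityMeasure (ν k)) →
    ∀ δ : ℝ, 0 < δ →
      (∀ s : Fin m → ℝ, (∀ i, |s i| < δ) →
        (∀ k, Integrable (fun x => Real.exp (∑ i, s i * x i)) (ν k)) ∧
          ∃ L : ℝ, Tendsto (fun k => ∫ x, Real.exp (∑ i, s i * x i) ∂(ν k)) atTop (𝓝 L)) →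
      ∀ p : Fin m → ℕ, ∃ c : ℝ, Tendsto (fun k => ∫ x, ∏ i, x i ^ p i ∂(ν k)) atTop (𝓝 c)

/-! ## §3 Stub statements (closed `Prop`s, `Statement.stub_…`; the registered stubs prove them by name) -/

namespace Statement

/-- **Stub 1 — ENGINE (borrowed; carries the universality content; hardest).** Along every scheme in the crux's
hypothesis block (block factor `M ≥ M₀(G,r)`, tuning window `θ < θ₀`), the flowed free energies with small REAL sources
converge along the full sequence. A source `s ∫ J E_τ` is a bounded smooth quasi-local perturbation of Wilson's action at
scale `√τ`, so this is the scalar (partition-function) form of (A); its natural proof is the promoted two-orbit chart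
`ChartExists` applied to scalar observables. Honours `not_withoutAF`: uses AF and `θ > 0` through `CruxHyp`/the window. -/
def stub_flowedFreeEnergyLimit : Prop :=
  ∀ (G : Type) [Group G] [TopologicalSpace G] [IsTopologicalGroup G] [CompactSpace G],
    IsCompactSimpleLieGroup G →
      letI : MeasurableSpace G := borel G
      haveI : BorelSpace G := ⟨rfl⟩
      ∀ r : LatticeRep G, ∃ M₀ : ℕ, ∀ M : ℕ, M₀ ≤ M → 2 ≤ M → ∃ θ₀ : ℝ, 0 < θ₀ ∧
        ∀ (θ Δ : ℝ) (sch : SpeciesScheme (YMSpecies G)) (n : ℕ → ℕ),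
          0 < θ → θ < θ₀ → 0 < Δ → CruxHyp r M θ Δ sch n → FFEConv r sch

/-- **Stub 2 — FLOW CONTINUITY (true, M/L; tree debt).** `BoundedFlowedEnergyContinuous`. -/
def stub_flowContinuity : Prop := BoundedFlowedEnergyContinuous

/-- **Stub 3 — CURTISS, abstract (true, L; Literature/Probability grade).** `CurtissTheorem`. -/
def stub_curtiss : Prop := CurtissTheorem

/-- **Stub 4 — MOMENTS OF THE FLOWED FREE ENERGIES (glue, true, M).** Given Curtiss' theorem (by name) and the
continuity of the flowed observables: convergence of the flowed free energies on a real neighbourhood of `0` ⇒ convergence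
of every centred mixed flowed moment (push the torus Wilson measure forward under `U ↦ (X_k(τ,fᵢ)(U))ᵢ`, bounded continuous
hence with all exponential moments; `exp ∘ flowF` converges; expand the centred product). -/
def stub_momentsOfFreeEnergies : Prop :=
  CurtissTheorem →
    ∀ (G : Type) [Group G] [TopologicalSpace G] [IsTopologicalGroup G] [CompactSpace G]
      [MeasurableSpace G] [BorelSpace G] (r : LatticeRep G) (sch : SpeciesScheme (YMSpecies G)),
      FlowXContinuous r sch → FFEConv r sch → FlowMomentsConv r sch

/-- **Stub 5 — SMALL-FLOW-TIME TRANSFER (L/open; this line's one new UV statement).** Along every scheme of the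
hypothesis block: `SFTApprox` — a `k`-UNIFORM small-flow-time expansion of the curvature species at separated points,
`E_τ = c_E(τ)·[a⁻⁴(P − ⟨P⟩)] + O(τ)` inside correlators with off-diagonal real product tensors (Lüscher–Weisz: flowed
composites need no renormalisation; the bare `tr F²` density has a finite multiplicative renormalisation `1 + O(g₀²) → 1` at the
asymptotically free point, so `c = a⁻⁴` is the right weight; Suzuki / Del Debbio–Patella–Rago small-flow-time expansion,
Lüscher–Weisz 2011 §2). -/
def stub_smallFlowTimeTransfer : Prop :=
  ∀ (G : Type) [Group G] [TopologicalSpace G] [IsTopologicalGroup G] [CompactSpace G],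
    IsCompactSimpleLieGroup G →
      letI : MeasurableSpace G := borel G
      haveI : BorelSpace G := ⟨rfl⟩
      ∀ (r : LatticeRep G) (M : ℕ) (θ Δ : ℝ) (sch : SpeciesScheme (YMSpecies G)) (n : ℕ → ℕ),
        2 ≤ M → 0 < θ → 0 < Δ → CruxHyp r M θ Δ sch n → SFTApprox r sch

/-- **Stub 6 — UV REGULARITY (open; SHARED with line two-orbit).** By definition two-orbit's registered statement
`TwoOrbitSynchronisation.UVRegularity` (`…DefsB`): along a crux-admissible sequence with `ConvProducts`,
`UVB ∧ AsympEuclid ∧ ARP ∧ ND2 ∧ ND3`. Any proof of either closes both (`Iff.rfl`). -/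
def stub_uvRegularity : Prop := UVRegularity

/-- **Stub 7 — CLUSTERING LEG (open IR input; SHARED with line two-orbit).** By definition two-orbit's registered
statement `TwoOrbitSynchronisation.ClusteringLeg` (`…DefsB`): `… → ConvProducts → UVB → UCL`. -/
def stub_clustering : Prop := ClusteringLeg

end Statement

/-! ## §4 Registered glue of the composition (proved) -/

/-- **3ε lemma.** A real sequence that is, for every `ε > 0`, eventually `ε`-close to SOME convergent sequence is
Cauchy, hence convergent. [folklore] -/
theorem tendsto_of_eventually_approx :
    ∀ {u : ℕ → ℝ}, (∀ ε : ℝ, 0 < ε → ∃ v : ℕ → ℝ, (∃ c, Tendsto v atTop (𝓝 c)) ∧ ∀ᶠ k in atTop, |u k - v k| ≤ ε) →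
      ∃ c, Tendsto u atTop (𝓝 c) := by
  intro u h
  have hc : CauchySeq u := by
    refine Metric.cauchySeq_iff.2 fun ε hε => ?_
    obtain ⟨v, ⟨c, hv⟩, huv⟩ := h (ε / 4) (by positivity)
    obtain ⟨N₁, hN₁⟩ := Metric.cauchySeq_iff.1 hv.cauchySeq (ε / 4) (by positivity)
    obtain ⟨N₂, hN₂⟩ := eventually_atTop.1 huv
    refine ⟨max N₁ N₂, fun m hm n hn => ?_⟩
    have h1 := hN₂ m (le_of_max_le_right hm)
    have h2 := hN₂ n (le_of_max_le_right hn)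
    have h3 := hN₁ m (le_of_max_le_left hm) n (le_of_max_le_left hn)
    rw [Real.dist_eq] at h3 ⊢
    have h2' : |v n - u n| ≤ ε / 4 := by rw [abs_sub_comm]; exact h2
    calc |u m - u n| = |(u m - v m) + (v m - v n) + (v n - u n)| := by ring_nf
      _ ≤ |u m - v m| + |v m - v n| + |v n - u n| := abs_add_three _ _ _
      _ < ε := by linarith
  exact cauchySeq_tendsto_of_complete hc

section Compose

variable {G : Type} [Group G] [TopologicalSpace G] [IsTopologicalGroup G] [CompactSpace G]
  [MeasurableSpace G] [BorelSpace G]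

omit [BorelSpace G] in
/-- The flowed observables are finite sums of constants times the flowed density, hence continuous once the latter is. [folklore] -/
theorem flowXContinuous_of (hF : BoundedFlowedEnergyContinuous) (r : LatticeRep G)
    (sch : SpeciesScheme (YMSpecies G)) : FlowXContinuous r sch := by
  intro τ hτ f k
  unfold flowX
  refine continuous_finsetSum _ fun x _ => continuous_const.mul ?_
  exact hF G r (sch.side k) (τ / sch.a k ^ 2) (div_nonneg hτ.le (sq_nonneg _)) x

/-- **Flowed moments converge at every flow time + uniform small-flow-time approximation ⇒ the canonical unflowed
curvature functions converge on off-diagonal products along the full sequence** (3ε). [folklore] -/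
theorem convProducts_of_sft (r : LatticeRep G) (sch : SpeciesScheme (YMSpecies G))
    (hMom : FlowMomentsConv r sch) (hSFT : SFTApprox r sch) : ConvProducts r sch := by
  obtain ⟨cE, hS⟩ := hSFT
  intro p hp f hoff
  refine tendsto_of_eventually_approx fun ε hε => ?_
  obtain ⟨τ, hτ, hev⟩ := hS p hp f hoff ε hε
  obtain ⟨c, hc⟩ := hMom p f τ hτ
  exact ⟨fun k => cE τ ^ p * flowCMoment r sch τ p f k, ⟨cE τ ^ p * c, hc.const_mul _⟩, hev⟩

end Compose

/-- The torus Wilson measure of the scheme is a probability measure (continuity of `r.ρ`). [folklore] -/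
instance isProbabilityMeasure_μW {G : Type} [Group G] [TopologicalSpace G] [IsTopologicalGroup G] [CompactSpace G]
    [MeasurableSpace G] [BorelSpace G] (r : LatticeRep G) (sch : SpeciesScheme (YMSpecies G)) (k : ℕ) :
    IsProbabilityMeasure (μW r sch k) :=
  isProbabilityMeasure_wilsonMeasure (d := 4) (L := sch.side k) r.ρ r.continuous (sch.β k)

/-! ## §5 Reshaped stub 5 (wave-1 determination, 2026-08-16): the small-flow-time transfer in its weaker, `k`-matched form

The wave-1 worker's determination of `stub_smallFlowTimeTransfer` (open physics: no non-perturbative small-flow-time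
expansion exists in any dimension; NOT mis-stated at the Lean level) recorded two harmless technicalities of `SFTApprox`:
a single `k`-independent matching constant `cE(τ)` must absorb the finite multiplicative renormalisation
`Z_k = 1 + O(g₀(a_k)²) → 1` of the bare density `a⁻⁴P`, which costs `k`-boundedness of the flowed moments — available in the
composition (`FlowMomentsConv`, the Curtiss output) but not among the stub's hypotheses; and the orientation conventions
(`energyDensity = 2∑(N − Re tr W_p) ≥ 0` versus `actionDensity = ∑ Re tr U_p`) make the expected `cE` NEGATIVE (≈ −½), which the
existential `cE` allows. The reshaped statement below takes `FlowMomentsConv` as a hypothesis and lets the matching constant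
depend on `k` with a limit; the old statement implies the new one (`sftApproxK_of_sftApprox`) and the new one still feeds the 3ε
lemma (`convProducts_of_sftK`). Registered stub: `stub_smallFlowTimeTransferK : Statement.stub_smallFlowTimeTransferK`. -/

section Reshape

variable {G : Type} [Group G] [TopologicalSpace G] [IsTopologicalGroup G] [CompactSpace G]
  [MeasurableSpace G] [BorelSpace G]

/-- (SMALL FLOW TIME, `k`-matched form) one family of matching constants `c_E(τ, k)`, convergent in `k` for each `τ > 0`,
such that for every off-diagonal real product tensor and every `ε > 0` some flow time `τ > 0` makes the canonical unflowed
`p`-point function `ε`-close to `c_E(τ,k)ᵖ ×` the centred flowed moment for all large `k`. A LINE STATEMENT (consumed by the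
composition through `convProducts_of_sftK`), not a named fact. -/
def SFTApproxK (r : LatticeRep G) (sch : SpeciesScheme (YMSpecies G)) : Prop :=
  ∃ cE : ℝ → ℕ → ℝ, (∀ τ : ℝ, 0 < τ → ∃ c : ℝ, Tendsto (cE τ) atTop (𝓝 c)) ∧
    ∀ (p : ℕ), p ≠ 0 → ∀ (f : Fin p → 𝓢(𝔼, ℝ)),
      IsOffDiagonal (SchwartzMap.tensorFin p fun i => ofRealTest (f i)) →
        ∀ ε : ℝ, 0 < ε → ∃ τ : ℝ, 0 < τ ∧ ∀ᶠ k in atTop,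
          |curvNPoint r sch k p f - cE τ k ^ p * flowCMoment r sch τ p f k| ≤ ε

/-- The planner's form implies the `k`-matched form (constant family). -/
theorem sftApproxK_of_sftApprox (r : LatticeRep G) (sch : SpeciesScheme (YMSpecies G))
    (h : SFTApprox r sch) : SFTApproxK r sch := by
  obtain ⟨cE, hS⟩ := h
  exact ⟨fun τ _ => cE τ, fun τ _ => ⟨cE τ, tendsto_const_nhds⟩, hS⟩

/-- **Flowed moments converge + `k`-matched small-flow-time approximation ⇒ `ConvProducts`** (3ε). -/
theorem convProducts_of_sftK (r : LatticeRep G) (sch : SpeciesScheme (YMSpecies G))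
    (hMom : FlowMomentsConv r sch) (hSFT : SFTApproxK r sch) : ConvProducts r sch := by
  obtain ⟨cE, hcE, hS⟩ := hSFT
  intro p hp f hoff
  refine tendsto_of_eventually_approx fun ε hε => ?_
  obtain ⟨τ, hτ, hev⟩ := hS p hp f hoff ε hε
  obtain ⟨c, hc⟩ := hMom p f τ hτ
  obtain ⟨c', hc'⟩ := hcE τ hτ
  exact ⟨fun k => cE τ k ^ p * flowCMoment r sch τ p f k, ⟨c' ^ p * c, (hc'.pow p).mul hc⟩, hev⟩

end Reshape

namespace Statement

/-- **Stub 5, reshaped — SMALL-FLOW-TIME TRANSFER, `k`-matched form (open UV input; replaces `stub_smallFlowTimeTransfer`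
in skeleton v3).** Along every scheme of the hypothesis block whose flowed moments converge: `SFTApproxK`. -/
def stub_smallFlowTimeTransferK : Prop :=
  ∀ (G : Type) [Group G] [TopologicalSpace G] [IsTopologicalGroup G] [CompactSpace G],
    IsCompactSimpleLieGroup G →
      letI : MeasurableSpace G := borel G
      haveI : BorelSpace G := ⟨rfl⟩
      ∀ (r : LatticeRep G) (M : ℕ) (θ Δ : ℝ) (sch : SpeciesScheme (YMSpecies G)) (n : ℕ → ℕ),
        2 ≤ M → 0 < θ → 0 < Δ → CruxHyp r M θ Δ sch n → FlowMomentsConv r sch → SFTApproxK r sch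

end Statement

end Summit.QuantumFields.YangMills.Cruxes.ContinuumLimitOnTrajectory.CurtissFlowedFreeEnergies

end
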